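import Summits.HodgeConjecture.CorCM.QuarticCMReflexPairHodge
import Literature.AlgebraicGeometry.Pohlmann1968.SeparatingCMFamilies
import HarnessLib

/-!
# Any two simple non-isogenous CM abelian surfaces (one CM field non-Galois, or the fields non-isomorphic): the Hodge
# conjecture on every `S₀^a × S₁^b` — the isomorphic-fields case in the two-field dress, and the synthesis

COR-CM (cell `pub-hodgecm2`, binder seat `b23` gen 28), count-neutral; NEW as stated, hence under `Summits/`.  Sequel of
`SimpleCMSurfacePairsHodge` (different Galois closures) and `QuarticCMReflexPairHodge` (a field and a non-isomorphic
partner in the same closure).  Here the two quartic CM fields are ISOMORPHIC, `e : K_{i₀} ≃ K_{i₁}`, `K_{i₀}` not Galois: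
with `a, ā, b, b̄`, the `4`-cycle `τ` and the reflection `τ₀` of seat p2 on `Hom(K_{i₀}, ℂ)`, the embedding
`c = a ∘ e⁻¹` of `K_{i₁}` is FIXED by `τ₀`; of the four types `{c, τc}, {c, τ̄c}, {c̄, τc}, {c̄, τ̄c}` of `K_{i₁}` the
first and last are CM-equivalent to `Φ_{i₀} = {a, b}`, `Φ̄_{i₀}` along `e`, `ρ ∘ e` — excluded for a SEPARATING family
(seat b16's `IsSeparatingFamily.eq_of_forall_mem_iff_comp_mem`) — and for the other two the eight balance identities at
`1, τ, τ², τ³, τ₀, τ₀τ, τ₀τ², τ₀τ³` force conjugation-invariance (seat b24's same-field theorem, here in the family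
language of `CMAlgebra.IsNondegenerateFamily` over two slots with different carrier fields):

* `isNondegenerateFamily_pair_of_reflection_fixed` — the combinatorial core (`τ₀c = c`, type `{c, τ̄c}`);
* **`isNondegenerateFamily_of_ringEquiv_of_isSeparatingFamily`** — `K_{i₀}` non-Galois quartic, `K_{i₁} ≅ K_{i₀}`,
  separating family ⟹ nondegenerate;
* **`hodgeConjectureFor_prod_simpleSurfaces_of_not_isGalois`** — THE SYNTHESIS: two SIMPLE, NON-ISOGENOUS CM abelian
  surfaces, `K_{i₀}` a non-Galois quartic CM field, `K_{i₁}` any quartic CM field: the Hodge conjecture and `B• = D•`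
  hold on every `S₀^a × S₁^b` (every `⨁_{j<N} A_{π j}`), UNCONDITIONALLY — non-isomorphic fields by
  `hodgeConjectureFor_prod_simpleSurfaces_of_isEmpty_ringEquiv`, isomorphic by this file.  (Two cyclic isomorphic
  fields carry no separating pair — all four types are Galois-conjugate — and are not treated.)

Theorems only, no definition, no `sorry`.

## References

* [MoonenZarhin1999LowDim] B. Moonen, Yu. Zarhin, Math. Ann. 315 (1999), "Hodge groups of simple abelian surfaces
  of CM-type" and Cor. (3.9).
* [Shimura1998] G. Shimura, *Abelian Varieties with Complex Multiplication and Modular Functions*, §8.4 Example (2)(C).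
* [Gordon1999HodgeAVSurvey] B. B. Gordon, *A survey of the Hodge conjecture for abelian varieties*, 7.4–7.5, §9.2–9.3, 10.10.
-/

noncomputable section

open CategoryTheory CategoryTheory.Limits NumberField NumberField.ComplexEmbedding IntermediateField Module

namespace Summit.HodgeConjecture.CorCM

open Literature.NumberTheory.ComplexMultiplication
open Literature.NumberTheory.ComplexMultiplication.CMTypeOps (mem_iff_conjugate_notMem mem_or_conjugate_mem)
open Literature.AlgebraicGeometry.Motives (AbelianVariety CMType)
open Literature.AlgebraicGeometry.HodgeTheory
open Literature.AlgebraicGeometry.ComplexMultiplication (IsCMTypeRealisation isSimple_iff_isPrimitive)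
open Literature.AlgebraicGeometry.VanGeemen1994 (hodgeClassSpan)
open Literature.AlgebraicGeometry.Pohlmann1968
open Literature.Barriers.HodgeConjecture (divisorClassesSpan)

section Core

variable {I : Type} {K : I → Type} [∀ i, Field (K i)] [∀ i, NumberField (K i)] [∀ i, IsCMField (K i)] [Fintype I]

omit [∀ i, NumberField (K i)] [∀ i, IsCMField (K i)] [Fintype I] in
/-- `Σ_i G(i) = G(i₀) + G(i₁)` on a two-slot index type. [folklore] -/
private theorem sum_eq_add_two' {M : Type*} [AddCommMonoid M] [Fintype I] {i₀ i₁ : I} (h01 : i₀ ≠ i₁)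
    (hI : ∀ j, j = i₀ ∨ j = i₁) (G : I → M) : ∑ i, G i = G i₀ + G i₁ := by
  classical
  have huniv : (Finset.univ : Finset I) = {i₀, i₁} := by
    ext j
    simpa using hI j
  rw [huniv, Finset.sum_pair h01]

/-- **The combinatorial core, fixed-point case**: two quartic slots; `τ` a `4`-cycle `a ↦ b ↦ ā ↦ b̄` and `τ₀` the
reflection fixing `a, ā` on the first; `τ²c = c̄`, `τ₀τc = τ³τ₀c` and `τ₀c = c` on the second; types `{a, b}` and
`{c, τ̄c}` (the "flipped" partner): the eight balance identities force conjugation-invariance.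
[cite: MoonenZarhin1999LowDim, "Hodge groups of simple abelian surfaces of CM-type"] [cite: Gordon1999HodgeAVSurvey, §9.2–9.3] -/
theorem isNondegenerateFamily_pair_of_reflection_fixed {i₀ i₁ : I} (h01 : i₀ ≠ i₁) (hI : ∀ j, j = i₀ ∨ j = i₁)
    (h4₀ : finrank ℚ (K i₀) = 4) (h4₁ : finrank ℚ (K i₁) = 4) {a b : K i₀ →+* ℂ} (hba : b ≠ a)
    (hba' : b ≠ conjugate a) {c : K i₁ →+* ℂ} {τ τ₀ : ℂ ≃+* ℂ} (hτa : τ • a = b) (hτb : τ • b = conjugate a)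
    (hτ₀a : τ₀ • a = a) (hτ₀b : τ₀ • b = conjugate b) (hτc : τ • τ • c = conjugate c)
    (hτ₀τc : τ₀ • τ • c = τ • τ • τ • τ₀ • c) (hτ₀c : τ₀ • c = c)
    {Φ : ∀ i, CMType (K i)} (hΦ₀ : ∀ s, s ∈ (Φ i₀).1 ↔ s = a ∨ s = b)
    (hΦ₁ : ∀ s, s ∈ (Φ i₁).1 ↔ s = c ∨ s = conjugate (τ • c)) : CMAlgebra.IsNondegenerateFamily Φ := by
  classical
  haveI : Nonempty I := ⟨i₀⟩
  have hτa' : τ • conjugate a = conjugate b := by rw [QuarticCM.smul_conjugate, hτa]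
  have hτb' : τ • conjugate b = a := by rw [QuarticCM.smul_conjugate, hτb, involutive_conjugate (K i₀) a]
  have hτ₀a' : τ₀ • conjugate a = conjugate a := by rw [QuarticCM.smul_conjugate, hτ₀a]
  have hτ₀b' : τ₀ • conjugate b = b := by rw [QuarticCM.smul_conjugate, hτ₀b, involutive_conjugate (K i₀) b]
  have hΦa : a ∈ (Φ i₀).1 := (hΦ₀ a).2 (Or.inl rfl); have hΦb : b ∈ (Φ i₀).1 := (hΦ₀ b).2 (Or.inr rfl)
  have hΦna : conjugate a ∉ (Φ i₀).1 := (mem_iff_conjugate_notMem (Φ i₀) a).1 hΦa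
  have hΦnb : conjugate b ∉ (Φ i₀).1 := (mem_iff_conjugate_notMem (Φ i₀) b).1 hΦb
  -- second slot: `d = τc`, `τ d = c̄`, `τ c̄ = d̄`, `τ d̄ = c`; `τ₀`: `c, c̄` fixed, `d ↔ d̄`
  set d : K i₁ →+* ℂ := τ • c with hd
  have hτd : τ • d = conjugate c := hτc
  have hτc' : τ • conjugate c = conjugate d := by rw [QuarticCM.smul_conjugate]
  have hτd' : τ • conjugate d = c := by rw [QuarticCM.smul_conjugate, hτd, involutive_conjugate (K i₁) c]
  have hdc : d ≠ c := by
    intro h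
    have h2 : τ • τ • c = c := by rw [← hd, h, ← hd, h]
    exact QuarticCM.conjugate_ne c (hτc.symm.trans h2)
  have hdc' : d ≠ conjugate c := by
    intro h
    have h1 : τ • conjugate c = conjugate c := by rwa [h] at hτd
    have h2 : τ • c = c := by
      have := congrArg conjugate h1
      rwa [QuarticCM.smul_conjugate, involutive_conjugate (K i₁) (τ • c), involutive_conjugate (K i₁) c] at this
    exact hdc (hd.trans h2)
  have hτ₀c' : τ₀ • conjugate c = conjugate c := by rw [QuarticCM.smul_conjugate, hτ₀c]
  have hτ₀d : τ₀ • d = conjugate d := by rw [hd, hτ₀τc, hτ₀c, hτc, hτc']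
  have hτ₀d' : τ₀ • conjugate d = d := by rw [QuarticCM.smul_conjugate, hτ₀d, involutive_conjugate (K i₁) d]
  have hΦc : c ∈ (Φ i₁).1 := (hΦ₁ c).2 (Or.inl rfl)
  have hΦd' : conjugate d ∈ (Φ i₁).1 := (hΦ₁ (conjugate d)).2 (Or.inr rfl)
  have hΦnc : conjugate c ∉ (Φ i₁).1 := (mem_iff_conjugate_notMem (Φ i₁) c).1 hΦc
  have hΦnd : d ∉ (Φ i₁).1 := fun h => (mem_iff_conjugate_notMem (Φ i₁) d).1 h hΦd'
  rw [CMAlgebra.isNondegenerateFamily_iff_forall_nat_symm]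
  intro f hf
  have hsum : ∀ g : ℂ ≃+* ℂ,
      ∑ x : (i : I) × (K i →+* ℂ), (f x : ℚ) * translateInd (CMAlgebra.familyType Φ) g x =
        (f ⟨i₀, a⟩ : ℚ) * translateInd (Φ i₀).1 g a + f ⟨i₀, conjugate a⟩ * translateInd (Φ i₀).1 g (conjugate a) +
          f ⟨i₀, b⟩ * translateInd (Φ i₀).1 g b + f ⟨i₀, conjugate b⟩ * translateInd (Φ i₀).1 g (conjugate b) +
        ((f ⟨i₁, c⟩ : ℚ) * translateInd (Φ i₁).1 g c + f ⟨i₁, conjugate c⟩ * translateInd (Φ i₁).1 g (conjugate c) +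
          f ⟨i₁, d⟩ * translateInd (Φ i₁).1 g d + f ⟨i₁, conjugate d⟩ * translateInd (Φ i₁).1 g (conjugate d)) :=
    fun g => by
    rw [Fintype.sum_sigma, sum_eq_add_two' h01 hI, QuarticCM.sum_eq_add_four h4₀ hba hba',
      QuarticCM.sum_eq_add_four h4₁ hdc hdc']
    simp only [CMAlgebra.translateInd_familyType]
  have htot : ∑ x : (i : I) × (K i →+* ℂ), (f x : ℚ) =
      (f ⟨i₀, a⟩ : ℚ) + f ⟨i₀, conjugate a⟩ + f ⟨i₀, b⟩ + f ⟨i₀, conjugate b⟩ +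
        ((f ⟨i₁, c⟩ : ℚ) + f ⟨i₁, conjugate c⟩ + f ⟨i₁, d⟩ + f ⟨i₁, conjugate d⟩) := by
    rw [Fintype.sum_sigma, sum_eq_add_two' h01 hI, QuarticCM.sum_eq_add_four h4₀ hba hba',
      QuarticCM.sum_eq_add_four h4₁ hdc hdc']
  have E1 := hf 1; have E2 := hf τ; have E3 := hf (τ * τ); have E4 := hf (τ * τ * τ)
  have E5 := hf τ₀; have E6 := hf (τ₀ * τ); have E7 := hf (τ₀ * (τ * τ)); have E8 := hf (τ₀ * (τ * τ * τ))
  rw [hsum, htot] at E1 E2 E3 E4 E5 E6 E7 E8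
  simp only [translateInd, one_smul, mul_smul, hτa, hτa', hτb, hτb', hτ₀a, hτ₀a', hτ₀b, hτ₀b', ← hd, hτd, hτc',
    hτd', hτ₀c, hτ₀c', hτ₀d, hτ₀d', hΦa, hΦb, hΦna, hΦnb, hΦc, hΦd', hΦnc, hΦnd,
    if_true, if_false, mul_one, mul_zero, add_zero, zero_add] at E1 E2 E3 E4 E5 E6 E7 E8
  have kc : (f ⟨i₁, conjugate c⟩ : ℚ) = f ⟨i₁, c⟩ := by linarith
  have kd : (f ⟨i₁, conjugate d⟩ : ℚ) = f ⟨i₁, d⟩ := by linarith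
  have ka : (f ⟨i₀, conjugate a⟩ : ℚ) = f ⟨i₀, a⟩ := by linarith
  have kb : (f ⟨i₀, conjugate b⟩ : ℚ) = f ⟨i₀, b⟩ := by linarith
  rintro ⟨i, s⟩
  change f ⟨i, conjugate s⟩ = f ⟨i, s⟩
  rcases hI i with rfl | rfl
  · rcases QuarticCM.eq_or_eq_or_eq_or_eq h4₀ hba hba' s with rfl | rfl | rfl | rfl
    · exact_mod_cast ka
    · rw [involutive_conjugate (K i) a]; exact_mod_cast ka.symm
    · exact_mod_cast kb
    · rw [involutive_conjugate (K i) b]; exact_mod_cast kb.symm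
  · rcases QuarticCM.eq_or_eq_or_eq_or_eq h4₁ hdc hdc' s with rfl | rfl | rfl | rfl
    · exact_mod_cast kc
    · rw [involutive_conjugate (K i) c]; exact_mod_cast kc.symm
    · exact_mod_cast kd
    · rw [involutive_conjugate (K i) d]; exact_mod_cast kd.symm

end Core

/-! ### Isomorphic fields: the separating pairs are the nondegenerate ones -/

section Dress

variable {I : Type} {K : I → Type} [∀ i, Field (K i)] [∀ i, NumberField (K i)] [∀ i, IsCMField (K i)] [Fintype I]

omit [∀ i, IsCMField (K i)] [Fintype I] in
/-- Two automorphisms of `ℂ` agreeing on every embedding of `K_{i₀}` agree on every embedding of a field `K_{i₁}` all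
of whose embeddings take values in `L_{i₀}`. [folklore] -/
private theorem smul_eq_smul_of_forall_smul_eq' {i₀ i₁ : I} {σ σ' : ℂ ≃+* ℂ}
    (h : ∀ s : K i₀ →+* ℂ, σ • s = σ' • s)
    (hL : ∀ (s' : K i₁ →+* ℂ) (x : K i₁), s' x ∈ normalClosure ℚ (K i₀) ℂ) (s' : K i₁ →+* ℂ) :
    σ • s' = σ' • s' :=
  RingHom.ext fun x => apply_eq_of_forall_smul_eq i₀ h (hL s' x)

omit [∀ i, NumberField (K i)] [∀ i, IsCMField (K i)] [Fintype I] in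
/-- `(τ ∘ u) ∘ e = τ ∘ (u ∘ e)`. [folklore] -/
private theorem smul_comp {i₀ i₁ : I} (τ : ℂ ≃+* ℂ) (u : K i₁ →+* ℂ) (e : K i₀ →+* K i₁) :
    (τ • u).comp e = τ • (u.comp e) := by
  rw [ringEquiv_smul_def, ringEquiv_smul_def, RingHom.comp_assoc]

omit [∀ i, NumberField (K i)] [Fintype I] in
/-- `ū ∘ e = \overline{u ∘ e}`. [folklore] -/
private theorem conjugate_comp {i₀ i₁ : I} (u : K i₁ →+* ℂ) (e : K i₀ →+* K i₁) :
    (conjugate u).comp e = conjugate (u.comp e) :=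
  RingHom.ext fun x => by rw [RingHom.comp_apply, conjugate_coe_eq, conjugate_coe_eq, RingHom.comp_apply]

/-- **Isomorphic fields, separating family ⟹ nondegenerate.**  `K_{i₀}` a non-Galois quartic CM field,
`e : K_{i₀} ≃ K_{i₁}`, `(Φ_{i₀}, Φ_{i₁})` a SEPARATING family (no CM-equivalence along any field isomorphism).  Then the
family is nondegenerate: with `c = a ∘ e⁻¹` (fixed by `τ₀`) the types `{c, τc}` and `{c̄, τ̄c}` are equivalent to
`Φ_{i₀}`, `Φ̄_{i₀}` along `e`, `ρe`, and the remaining two fall under the fixed-point core.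
[cite: MoonenZarhin1999LowDim, "Hodge groups of simple abelian surfaces of CM-type"] [cite: Shimura1998, §8.4 Example (2)(C)] -/
theorem isNondegenerateFamily_of_ringEquiv_of_isSeparatingFamily {i₀ i₁ : I} (h01 : i₀ ≠ i₁)
    (hI : ∀ j, j = i₀ ∨ j = i₁) (h4₀ : finrank ℚ (K i₀) = 4) (hK₀ : ¬ IsGalois ℚ (K i₀))
    (h4₁ : finrank ℚ (K i₁) = 4) (e : K i₀ ≃+* K i₁) {Φ : ∀ i, CMType (K i)}
    (hsep : CMAlgebra.IsSeparatingFamily Φ) : CMAlgebra.IsNondegenerateFamily Φ := by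
  -- slot `i₀`
  obtain ⟨a, b, hba, hba', hΦ₀⟩ := QuarticCM.exists_mem_mem_ne h4₀ (Φ i₀)
  obtain ⟨τ, hτa, hτb⟩ := QuarticCM.exists_ringAut_smul_eq_smul_eq_conjugate h4₀ hK₀ hba hba'
  obtain ⟨τ₀, hτ₀a, hτ₀b⟩ := QuarticCM.exists_ringAut_smul_eq_self_smul_eq_conjugate_of_not_isGalois h4₀ hK₀ hba hba'
  have hτa' : τ • conjugate a = conjugate b := by rw [QuarticCM.smul_conjugate, hτa]
  have hτb' : τ • conjugate b = a := by rw [QuarticCM.smul_conjugate, hτb, involutive_conjugate (K i₀) a]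
  have hτ₀a' : τ₀ • conjugate a = conjugate a := by rw [QuarticCM.smul_conjugate, hτ₀a]
  have hτ₀b' : τ₀ • conjugate b = b := by rw [QuarticCM.smul_conjugate, hτ₀b, involutive_conjugate (K i₀) b]
  have hΦa : a ∈ (Φ i₀).1 := (hΦ₀ a).2 (Or.inl rfl); have hΦb : b ∈ (Φ i₀).1 := (hΦ₀ b).2 (Or.inr rfl)
  have hΦna : conjugate a ∉ (Φ i₀).1 := (mem_iff_conjugate_notMem (Φ i₀) a).1 hΦa
  have hΦnb : conjugate b ∉ (Φ i₀).1 := (mem_iff_conjugate_notMem (Φ i₀) b).1 hΦb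
  have h1 : ∀ s : K i₀ →+* ℂ, (τ * τ) • s = (starRingAut : ℂ ≃+* ℂ) • s := by
    intro s
    rw [mul_smul, conj_smul_eq_conjugate]
    rcases QuarticCM.eq_or_eq_or_eq_or_eq h4₀ hba hba' s with rfl | rfl | rfl | rfl
    · rw [hτa, hτb]
    · rw [hτa', hτb', involutive_conjugate (K i₀) a]
    · rw [hτb, hτa']
    · rw [hτb', hτa, involutive_conjugate (K i₀) b]
  have h2 : ∀ s : K i₀ →+* ℂ, (τ₀ * τ) • s = (τ * τ * τ * τ₀) • s := by
    intro s
    simp only [mul_smul]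
    rcases QuarticCM.eq_or_eq_or_eq_or_eq h4₀ hba hba' s with rfl | rfl | rfl | rfl
    · rw [hτa, hτ₀b, hτ₀a, hτa, hτb, hτa']
    · rw [hτa', hτ₀b', hτ₀a', hτa', hτb', hτa]
    · rw [hτb, hτ₀a', hτ₀b, hτb', hτa, hτb]
    · rw [hτb', hτ₀a, hτ₀b', hτb, hτa', hτb']
  -- slot `i₁`: embeddings valued in `L₀`; `c = a ∘ e⁻¹` is fixed by `τ₀`
  have hL : ∀ (u : K i₁ →+* ℂ) (x : K i₁), u x ∈ normalClosure ℚ (K i₀) ℂ := fun u x => by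
    have h := apply_mem_normalClosure i₀ (u.comp e.toRingHom) (e.symm x)
    rwa [RingHom.comp_apply, RingEquiv.toRingHom_eq_coe, RingEquiv.coe_toRingHom, e.apply_symm_apply] at h
  have g1 : ∀ u : K i₁ →+* ℂ, τ • τ • u = conjugate u := fun u => by
    have h := smul_eq_smul_of_forall_smul_eq' h1 hL u
    rwa [mul_smul, conj_smul_eq_conjugate] at h
  have g2 : ∀ u : K i₁ →+* ℂ, τ₀ • τ • u = τ • τ • τ • τ₀ • u := fun u => by
    have h := smul_eq_smul_of_forall_smul_eq' h2 hL u
    simpa only [mul_smul] using h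
  set c : K i₁ →+* ℂ := a.comp e.symm.toRingHom with hc
  have hce : ∀ u : K i₁ →+* ℂ, u = (u.comp e.toRingHom).comp e.symm.toRingHom := fun u =>
    RingHom.ext fun x => by simp
  have hcea : c.comp e.toRingHom = a := RingHom.ext fun x => by simp [hc]
  have hτ₀c : τ₀ • c = c := by
    rw [hc, ← smul_comp, hτ₀a]
  have hτc : τ • τ • c = conjugate c := g1 c
  set d : K i₁ →+* ℂ := τ • c with hd
  have hdeb : d.comp e.toRingHom = b := by rw [hd, smul_comp, hcea, hτa]
  have hdc : d ≠ c := by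
    intro h
    have h2' : τ • τ • c = c := by rw [← hd, h, ← hd, h]
    exact QuarticCM.conjugate_ne c (hτc.symm.trans h2')
  have hdc' : d ≠ conjugate c := by
    intro h
    have h1' : τ • conjugate c = conjugate c := by
      have h0 : τ • d = conjugate c := hτc
      rwa [h] at h0
    have h2' : τ • c = c := by
      have := congrArg conjugate h1'
      rwa [QuarticCM.smul_conjugate, involutive_conjugate (K i₁) (τ • c), involutive_conjugate (K i₁) c] at this
    exact hdc (hd.trans h2')
  -- pulling a type of `K_{i₁}` back along an isomorphism
  have hpull : ∀ (e' : K i₀ ≃+* K i₁) (x y : K i₁ →+* ℂ), y ≠ x → y ≠ conjugate x →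
      (∀ s, s ∈ (Φ i₁).1 ↔ s = x ∨ s = y) → x.comp e'.toRingHom ∈ (Φ i₀).1 → y.comp e'.toRingHom ∈ (Φ i₀).1 →
      False := by
    intro e' x y hyx hyx' hΦ₁ hx hy
    refine h01 (hsep.eq_of_forall_mem_iff_comp_mem e' fun u => ?_)
    have hnx : (conjugate x).comp e'.toRingHom ∉ (Φ i₀).1 := by
      rw [conjugate_comp]; exact (mem_iff_conjugate_notMem (Φ i₀) _).1 hx
    have hny : (conjugate y).comp e'.toRingHom ∉ (Φ i₀).1 := by
      rw [conjugate_comp]; exact (mem_iff_conjugate_notMem (Φ i₀) _).1 hy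
    have hΦx : x ∈ (Φ i₁).1 := (hΦ₁ x).2 (Or.inl rfl)
    have hΦy : y ∈ (Φ i₁).1 := (hΦ₁ y).2 (Or.inr rfl)
    rcases QuarticCM.eq_or_eq_or_eq_or_eq h4₁ hyx hyx' u with rfl | rfl | rfl | rfl
    · exact iff_of_true hΦx hx
    · exact iff_of_false ((mem_iff_conjugate_notMem (Φ i₁) _).1 hΦx) hnx
    · exact iff_of_true hΦy hy
    · exact iff_of_false ((mem_iff_conjugate_notMem (Φ i₁) _).1 hΦy) hny
  -- the four types of `K_{i₁}` through the memberships of `c`, `d`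
  rcases mem_or_conjugate_mem (Φ i₁) c with hΦc | hΦc' <;> rcases mem_or_conjugate_mem (Φ i₁) d with hΦd | hΦd'
  · -- `{c, d}`: equivalent to `Φ_{i₀}` along `e`
    exfalso
    refine hpull e c d hdc hdc' (fun s => ?_) (by rw [hcea]; exact hΦa) (by rw [hdeb]; exact hΦb)
    have hnc := (mem_iff_conjugate_notMem (Φ i₁) c).1 hΦc
    have hnd := (mem_iff_conjugate_notMem (Φ i₁) d).1 hΦd
    rcases QuarticCM.eq_or_eq_or_eq_or_eq h4₁ hdc hdc' s with rfl | rfl | rfl | rfl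
    · exact iff_of_true hΦc (Or.inl rfl)
    · exact iff_of_false hnc (by rintro (h | h); exacts [QuarticCM.conjugate_ne c h, hdc' h.symm])
    · exact iff_of_true hΦd (Or.inr rfl)
    · refine iff_of_false hnd ?_
      rintro (h | h)
      · exact hdc' (by rw [← involutive_conjugate (K i₁) d, h])
      · exact QuarticCM.conjugate_ne d h
  · -- `{c, d̄}`: the fixed-point core
    refine isNondegenerateFamily_pair_of_reflection_fixed h01 hI h4₀ h4₁ hba hba' hτa hτb hτ₀a hτ₀b hτc (g2 c) hτ₀c
      hΦ₀ fun s => ?_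
    have hnc := (mem_iff_conjugate_notMem (Φ i₁) c).1 hΦc
    have hnd : d ∉ (Φ i₁).1 := fun h => (mem_iff_conjugate_notMem (Φ i₁) d).1 h hΦd'
    rcases QuarticCM.eq_or_eq_or_eq_or_eq h4₁ hdc hdc' s with rfl | rfl | rfl | rfl
    · exact iff_of_true hΦc (Or.inl rfl)
    · refine iff_of_false hnc ?_
      rintro (h | h)
      · exact QuarticCM.conjugate_ne c h
      · exact hdc ((involutive_conjugate (K i₁)).injective h).symm
    · refine iff_of_false hnd ?_
      rintro (h | h)
      · exact hdc h
      · exact QuarticCM.conjugate_ne d h.symm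
    · exact iff_of_true hΦd' (Or.inr rfl)
  · -- `{c̄, d}`: the fixed-point core for `c̄` (`τ c̄ = d̄`, `\overline{τ c̄} = d`)
    have hτcc : τ • conjugate c = conjugate d := by rw [QuarticCM.smul_conjugate]
    have hτ₀cc : τ₀ • conjugate c = conjugate c := by rw [QuarticCM.smul_conjugate, hτ₀c]
    refine isNondegenerateFamily_pair_of_reflection_fixed h01 hI h4₀ h4₁ hba hba' hτa hτb hτ₀a hτ₀b (g1 _) (g2 _)
      hτ₀cc hΦ₀ fun s => ?_
    rw [hτcc, involutive_conjugate (K i₁) d]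
    have hnc : c ∉ (Φ i₁).1 := fun h => (mem_iff_conjugate_notMem (Φ i₁) c).1 h hΦc'
    have hnd := (mem_iff_conjugate_notMem (Φ i₁) d).1 hΦd
    rcases QuarticCM.eq_or_eq_or_eq_or_eq h4₁ hdc hdc' s with rfl | rfl | rfl | rfl
    · refine iff_of_false hnc ?_
      rintro (h | h)
      · exact QuarticCM.conjugate_ne c h.symm
      · exact hdc h.symm
    · exact iff_of_true hΦc' (Or.inl rfl)
    · exact iff_of_true hΦd (Or.inr rfl)
    · refine iff_of_false hnd ?_
      rintro (h | h)
      · exact hdc ((involutive_conjugate (K i₁)).injective h)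
      · exact QuarticCM.conjugate_ne d h
  · -- `{c̄, d̄}`: equivalent to `Φ̄_{i₀}` along `ρ e`
    exfalso
    let e' : K i₀ ≃+* K i₁ := (conjGal : K i₀ ≃ₐ[ℚ] K i₀).toRingEquiv.trans e
    have hcomp : ∀ u : K i₁ →+* ℂ, u.comp e'.toRingHom = conjugate (u.comp e.toRingHom) := fun u => by
      rw [CyclicSextic.conjugate_eq_comp_conjGal]
      rfl
    have hcd : conjugate d ≠ conjugate c := fun h => hdc ((involutive_conjugate (K i₁)).injective h)
    have hcd' : conjugate d ≠ conjugate (conjugate c) := by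
      rw [involutive_conjugate (K i₁) c]; exact fun h => hdc' ((involutive_conjugate (K i₁)).injective
        (by rw [involutive_conjugate (K i₁) c]; exact h))
    refine hpull e' (conjugate c) (conjugate d) hcd hcd' (fun s => ?_)
      (by rw [hcomp, conjugate_comp, hcea, involutive_conjugate (K i₀) a]; exact hΦa)
      (by rw [hcomp, conjugate_comp, hdeb, involutive_conjugate (K i₀) b]; exact hΦb)
    have hnc : c ∉ (Φ i₁).1 := fun h => (mem_iff_conjugate_notMem (Φ i₁) c).1 h hΦc'
    have hnd : d ∉ (Φ i₁).1 := fun h => (mem_iff_conjugate_notMem (Φ i₁) d).1 h hΦd'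
    rcases QuarticCM.eq_or_eq_or_eq_or_eq h4₁ hdc hdc' s with rfl | rfl | rfl | rfl
    · refine iff_of_false hnc ?_
      rintro (h | h)
      · exact QuarticCM.conjugate_ne c h.symm
      · exact hdc' (by rw [h, involutive_conjugate (K i₁) d])
    · exact iff_of_true hΦc' (Or.inl rfl)
    · refine iff_of_false hnd ?_
      rintro (h | h)
      · exact hdc' h
      · exact QuarticCM.conjugate_ne d h.symm
    · exact iff_of_true hΦd' (Or.inr rfl)

end Dress

/-! ### The synthesis -/

section Geometry

variable {I : Type} {K : I → Type} [∀ i, Field (K i)] [∀ i, NumberField (K i)] [∀ i, IsCMField (K i)] [Fintype I]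
  [Nonempty I] {Φ : ∀ i, CMType (K i)}
variable {A : I → AbelianVariety ℂ} {ι : ∀ i, 𝓞 (K i) →+* End (A i)}
  {θ : ∀ i, K i →+* Module.End ℂ (complexBetti (A i).X 1)}

/-- **Two simple, non-isogenous CM abelian surfaces, `K_{i₀}` a NON-GALOIS quartic CM field, `K_{i₁}` any quartic CM
field: the family is nondegenerate** (separating by simplicity and non-isogeny; `K_{i₁} ≇ K_{i₀}`: different or equal
closures; `K_{i₁} ≅ K_{i₀}`: the fixed-point core). [cite: MoonenZarhin1999LowDim, "Hodge groups of simple abelian surfaces of CM-type" and Cor. (3.9)] -/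
theorem isNondegenerateFamily_simpleSurfaces_of_not_isGalois {i₀ i₁ : I} (h01 : i₀ ≠ i₁)
    (hI : ∀ j, j = i₀ ∨ j = i₁) (h4 : ∀ i, finrank ℚ (K i) = 4) (hK₀ : ¬ IsGalois ℚ (K i₀))
    (hA : ∀ i, IsCMTypeRealisation (Φ i) (A i) (ι i) (θ i)) (hS : ∀ i, (A i).IsSimple)
    (hniso : ∀ i j, i ≠ j → ¬ AbelianVariety.IsIsogenous (A i) (A j)) : CMAlgebra.IsNondegenerateFamily Φ := by
  have hsep : CMAlgebra.IsSeparatingFamily Φ :=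
    CMAlgebra.isSeparatingFamily_of_isSimple_of_pairwise_not_isIsogenous hA hS hniso
  by_cases hKK : Nonempty (K i₀ ≃+* K i₁)
  · obtain ⟨e⟩ := hKK
    exact isNondegenerateFamily_of_ringEquiv_of_isSeparatingFamily h01 hI (h4 i₀) hK₀ (h4 i₁) e hsep
  · rw [not_nonempty_iff] at hKK
    by_cases hL : normalClosure ℚ (K i₀) ℂ = normalClosure ℚ (K i₁) ℂ
    · exact isNondegenerateFamily_pair_of_normalClosure_eq_of_isEmpty h01 hI (h4 i₀) (h4 i₁) hL hKK Φ
    · have hreal : ∀ x : ℂ, x ∈ normalClosure ℚ (K i₀) ℂ → x ∈ normalClosure ℚ (K i₁) ℂ → starRingEnd ℂ x = x :=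
        fun x hx₀ hx₁ => conj_apply_eq_of_mem_inf_of_normalClosure_ne (h4 i₀) (h4 i₁)
          (not_biquadratic_of_isPrimitive i₀ (h4 i₀)
            ((isSimple_iff_isPrimitive (hA i₀) (Classical.arbitrary (K i₀ →+* ℂ))).1 (hS i₀)))
          (not_biquadratic_of_isPrimitive i₁ (h4 i₁)
            ((isSimple_iff_isPrimitive (hA i₁) (Classical.arbitrary (K i₁ →+* ℂ))).1 (hS i₁))) hL hx₀ hx₁
      refine (isNondegenerateFamily_iff_of_partialConj (forall_exists_partialConj_pair h01 hI hreal) Φ).2 fun i => ?_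
      exact QuarticCM.isNondegenerate_of_isPrimitive (h4 i) (Φ i)
        ((isSimple_iff_isPrimitive (hA i) (Classical.arbitrary (K i →+* ℂ))).1 (hS i))

/-- **The Hodge conjecture and `B• = D•` on every `S₀^a × S₁^b` for two SIMPLE, NON-ISOGENOUS CM abelian surfaces,
one of whose quartic CM fields is NOT Galois** (the other arbitrary), UNCONDITIONALLY.  With both fields cyclic Galois
and non-isomorphic, `SimpleCMSurfacePairsHodge` / `QuarticCMReflexPairHodge` apply; two isomorphic cyclic quartic fields
carry no non-isogenous pair of simple surfaces. [cite: MoonenZarhin1999LowDim, "Hodge groups of simple abelian surfaces of CM-type" and Cor. (3.9)]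
[cite: Gordon1999HodgeAVSurvey, 7.5 and 10.10] -/
theorem hodgeConjectureFor_prod_simpleSurfaces_of_not_isGalois {i₀ i₁ : I} (h01 : i₀ ≠ i₁)
    (hI : ∀ j, j = i₀ ∨ j = i₁) (h4 : ∀ i, finrank ℚ (K i) = 4) (hK₀ : ¬ IsGalois ℚ (K i₀))
    (hA : ∀ i, IsCMTypeRealisation (Φ i) (A i) (ι i) (θ i)) (hS : ∀ i, (A i).IsSimple)
    (hniso : ∀ i j, i ≠ j → ¬ AbelianVariety.IsIsogenous (A i) (A j)) {N : ℕ} (π : Fin N → I) :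
    HodgeConjectureFor (⨁ fun j : Fin N => A (π j)).dim (⨁ fun j : Fin N => A (π j)).X ∧
      ∀ m : ℕ, hodgeClassSpan (⨁ fun j : Fin N => A (π j)).dim (⨁ fun j : Fin N => A (π j)).X m =
        divisorClassesSpan (⨁ fun j : Fin N => A (π j)).X (⨁ fun j : Fin N => A (π j)).dim m :=
  have hnd := isNondegenerateFamily_simpleSurfaces_of_not_isGalois h01 hI h4 hK₀ hA hS hniso
  ⟨hnd.hodgeConjectureFor_prod hA π, fun m => hnd.hodgeClassSpan_prod_eq_divisorClassesSpan hA π m⟩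

end Geometry

end Summit.HodgeConjecture.CorCM

end
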